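import Summits.QuantumFields.YangMills.Theses.UniversalDetector
import Summits.QuantumFields.YangMills.Theorems.UniversalDetectorHankelCeiling
import Summits.QuantumFields.YangMills.Theorems.UniversalDetectorHankelLongitudinal
import Summits.QuantumFields.YangMills.Theorems.UniversalDetectorBlindDetector
import Summits.QuantumFields.YangMills.Theorems.UniversalDetectorSchemeEdgeBitOfEntries

/-!
# Route `UniversalDetector`: `NT` FROM exactly the two remaining cruxes of LINE g11-1 «blind detector» —
`SchemeEdgeBit` (stmt-QuantumFields-24146) and the residual `SkewAtEdgeScheme` (stmt-QuantumFields-24149)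

Ideator seat ym-idea-8 g11 (lens «dual»).  Every support item in the cone of the route's certified `closes` (rev 10/11,
commit c7f46733e40a) is now in the tree BY NAME: `HankelCeiling` (`universalDetector_hankelCeiling`, 24000),
`HankelLongitudinal` (`universalDetector_hankelLongitudinal`, 24001) and — since 2026-08-29T08:06Z — `BlindDetector`
(`Theorems.universalDetector_blindDetector_proof`, 24148, p708125: blind sequential extraction p707587 ★ ym-spine-19353-p1 g26,
blind OS/Laplace rigidity p705845 ym-line-sfw-p2-w4 g22, composition p707667 this seat).  Hence, as an implication in the tree:

  `nt_of_cruxes : SchemeEdgeBit → SkewAtEdgeScheme → BalabanLadder.NT`,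

and, through the landed entry chain `Theorems/UniversalDetectorSchemeEdgeBitOfEntries.lean` (p704791), the same from each
documented stronger entry (`PlaneTightScheme` 23250, `SchemeEdgeLaws` 23999, `SchemeCurvatureLaws` 24087) in place of
`SchemeEdgeBit` — so the ledger census may count the route's open debt as «24146 (UV engine node; count once with the spine's
E0′) + 24149 (NT clause (ii) residual)», nothing more.

HONEST LABEL: implications only; neither crux is proved; `NT`, rung R2a and the Yang–Mills mass gap are NOT proved.
-/

set_option autoImplicit false

namespace Summit.QuantumFields.YangMills.Cruxes.UniversalDetectorBlindDetector

open Summit.QuantumFields.YangMills.Theses.UniversalDetector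

/-- **`NT` from exactly the route's two open cruxes** `SchemeEdgeBit` (24146) and `SkewAtEdgeScheme` (24149). -/
theorem nt_of_cruxes (hB : SchemeEdgeBit) (h5 : SkewAtEdgeScheme) :
    Summit.QuantumFields.YangMills.Theses.BalabanLadder.NT :=
  closes hB
    Summit.QuantumFields.YangMills.Cruxes.UniversalDetectorHankel.universalDetector_hankelCeiling
    Summit.QuantumFields.YangMills.Cruxes.UniversalDetectorHankel.universalDetector_hankelLongitudinal
    Summit.QuantumFields.YangMills.Theorems.universalDetector_blindDetector_proof h5

/-- `NT` from the entry `PlaneTightScheme` (23250) and the residual. -/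
theorem nt_of_planeTightScheme (hP : PlaneTightScheme) (h5 : SkewAtEdgeScheme) :
    Summit.QuantumFields.YangMills.Theses.BalabanLadder.NT :=
  nt_of_cruxes (Summit.QuantumFields.YangMills.Theorems.UniversalDetectorEntries.schemeEdgeBit_of_planeTightScheme hP) h5

/-- `NT` from the entry `SchemeEdgeLaws` (23999) and the residual. -/
theorem nt_of_schemeEdgeLaws (hE : SchemeEdgeLaws) (h5 : SkewAtEdgeScheme) :
    Summit.QuantumFields.YangMills.Theses.BalabanLadder.NT :=
  nt_of_cruxes (Summit.QuantumFields.YangMills.Theorems.UniversalDetectorEntries.schemeEdgeBit_of_schemeEdgeLaws hE) h5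

/-- `NT` from the strongest documented entry `SchemeCurvatureLaws` (24087) and the residual. -/
theorem nt_of_schemeCurvatureLaws (hK : SchemeCurvatureLaws) (h5 : SkewAtEdgeScheme) :
    Summit.QuantumFields.YangMills.Theses.BalabanLadder.NT :=
  nt_of_cruxes (Summit.QuantumFields.YangMills.Theorems.UniversalDetectorEntries.schemeEdgeBit_of_schemeCurvatureLaws hK) h5

end Summit.QuantumFields.YangMills.Cruxes.UniversalDetectorBlindDetector
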